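import Mathlib
import Literature.AlgebraicGeometry.Resolution.LogRegularScheme

/-!
# Adding free coordinates to a log-regular chart (Kato's condition (2.1))

Route `ResolutionOfSingularities/RadicialJung`, crux `CleanModelsSuffice`, line `Sketch`, stub
`stub_logRegularAddFree` (hypothesis `hAddFree` of `stub_charts`): the passage from the Kummer chart
`Q_a` to the full toroidal chart `Q_a × ℕ^{r'}` with the uncharged boundary parameters as free
coordinates.

Generic lemma about Kato's condition (2.1) for one chart `φ : P → (R, ·)` through a local ring `R`:
let `I := LogChart.nonunitIdeal P φ`, `F := LogChart.unitFace P φ`, and let `u₁, …, u_{r'} ∈ R` with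
`J = {j | u_j ∉ R^×}`. Put `P' := P × ℕ^{r'} ⊆ ℤ^{n + r'}` and `φ'(c, m) := φ(c) · ∏ u_j^{m_j}`. Then

* (A) `LogChart.nonunitIdeal P' φ' = I ⊔ (u_j : j ∈ J)` (`φ'(c, m)` is a unit iff `φ(c)` is a unit
  and `m_j = 0` for every `j ∈ J`);
* (B) the face of units of `φ'` is `{(c, m) | c ∈ F, m_j = 0 ∀ j ∈ J}`, whose `ℤ`-span is
  `span F × {z ∈ ℤ^{r'} | z_j = 0 ∀ j ∈ J}`, of rank `rank F + (r' - #J)`;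
* (C) hence, if `R ⧸ (I ⊔ (u_J))` is regular of dimension `dim (R ⧸ I) - #J` and `φ` satisfies
  Kato's (2.1), so does `φ'`: `dim R = dim (R/I) + (n - rank F) = dim (R/(I ⊔ (u_J))) + #J +
  (n - rank F) = dim (R ⧸ I') + ((n + r') - rank F')`.
-/

set_option linter.dupNamespace false

namespace Summit.ResolutionOfSingularities.ResolutionOfSingularities.Theorems.RadicialJung.CleanModelsSuffice

open Literature.AlgebraicGeometry.Resolution

/-- Rank bookkeeping for adjoining free coordinates: if a subgroup `M ⊆ ℤⁿ × ℤ^{r'}` consists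
exactly of the pairs `(s, z)` with `s` in a subgroup `S ⊆ ℤⁿ` and `z` vanishing on a set `J` of
coordinates, then `rank M = rank S + (r' - #J)`. [folklore] -/
theorem finrank_eq_finrank_add_card_free {n r' : ℕ} (S : Submodule ℤ (Fin n → ℤ))
    (J : Finset (Fin r')) (M : Submodule ℤ ((Fin n → ℤ) × (Fin r' → ℤ)))
    (h1 : ∀ v ∈ M, v.1 ∈ S) (h2 : ∀ v ∈ M, ∀ j ∈ J, v.2 j = 0)
    (h3 : ∀ s ∈ S, (s, (0 : Fin r' → ℤ)) ∈ M)
    (h4 : ∀ z : Fin r' → ℤ, (∀ j ∈ J, z j = 0) → ((0 : Fin n → ℤ), z) ∈ M) :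
    Module.finrank ℤ M = Module.finrank ℤ S + (r' - J.card) := by
  classical
  have hmem : ∀ q : S × ({j : Fin r' // j ∉ J} → ℤ),
      ((q.1 : Fin n → ℤ), fun j => if h : j ∈ J then (0 : ℤ) else q.2 ⟨j, h⟩) ∈ M := by
    intro q
    have := M.add_mem (h3 _ q.1.2)
      (h4 (fun j => if h : j ∈ J then (0 : ℤ) else q.2 ⟨j, h⟩) fun j hj => dif_pos hj)
    simpa only [Prod.mk_add_mk, add_zero, zero_add] using this
  let e : M ≃ₗ[ℤ] S × ({j : Fin r' // j ∉ J} → ℤ) :=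
    { toFun := fun v => (⟨(v : (Fin n → ℤ) × (Fin r' → ℤ)).1, h1 _ v.2⟩,
        fun j => (v : (Fin n → ℤ) × (Fin r' → ℤ)).2 j)
      map_add' := fun _ _ => rfl
      map_smul' := fun _ _ => rfl
      invFun := fun q => ⟨_, hmem q⟩
      left_inv := fun v => by
        refine Subtype.ext (Prod.ext rfl (funext fun j => ?_))
        by_cases hj : j ∈ J
        · simpa only [dif_pos hj] using (h2 _ v.2 j hj).symm
        · simp only [dif_neg hj]
      right_inv := fun q => by
        refine Prod.ext rfl (funext fun j => ?_)
        simp only [dif_neg j.2] }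
  rw [e.finrank_eq, Module.finrank_prod, Module.finrank_fintype_fun_eq_card]
  simp

/-- **Adding free coordinates to a log-regular chart.** Let `φ : P → (R, ·)` be a chart through a
local ring `R` satisfying Kato's condition (2.1) (`LogChart.IsLogRegularLocal`), `u₁, …, u_{r'} ∈ R`
with `J` the set of indices of the non-units among them, and suppose `R ⧸ (I ⊔ (u_j : j ∈ J))` is a
regular local ring of dimension `dim (R ⧸ I) - #J`, `I = LogChart.nonunitIdeal P φ` Kato's ideal.
Then the chart `φ' : P' = P × ℕ^{r'} → R`, `φ'(c, m) = φ(c) · ∏ u_j^{m_j}` (the `u_j` adjoined as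
free coordinates) again satisfies Kato's condition (2.1): its Kato ideal is `I ⊔ (u_j : j ∈ J)` and
its face of units has rank `rank F + (r' - #J)`. [cite: Kato1994, Def. (2.1)] -/
theorem stub_logRegularAddFree {R : Type} [CommRing R] [IsLocalRing R] {n : ℕ}
    (P : AddSubmonoid (Fin n → ℤ)) (φ : Multiplicative P →* R) (h : LogChart.IsLogRegularLocal P φ)
    (r' : ℕ) (u : Fin r' → R) (J : Finset (Fin r')) (hJ : ∀ j, j ∈ J ↔ ¬ IsUnit (u j))
    (hreg : IsRegularLocalRing (R ⧸ (LogChart.nonunitIdeal P φ ⊔ Ideal.span (u '' (J : Set (Fin r'))))))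
    (hdim : ringKrullDim (R ⧸ (LogChart.nonunitIdeal P φ ⊔ Ideal.span (u '' (J : Set (Fin r'))))) +
      (J.card : WithBot ℕ∞) = ringKrullDim (R ⧸ LogChart.nonunitIdeal P φ))
    (P' : AddSubmonoid (Fin (n + r') → ℤ))
    (hP' : ∀ c : Fin (n + r') → ℤ, c ∈ P' ↔
      (fun i : Fin n => c (Fin.castAdd r' i)) ∈ P ∧ ∀ j : Fin r', 0 ≤ c (Fin.natAdd n j))
    (φ' : Multiplicative P' →* R)
    (hφ' : ∀ c : P', φ' (Multiplicative.ofAdd c) =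
      φ (Multiplicative.ofAdd ⟨fun i : Fin n => (c : Fin (n + r') → ℤ) (Fin.castAdd r' i),
        ((hP' c).1 c.2).1⟩) *
        ∏ j : Fin r', u j ^ ((c : Fin (n + r') → ℤ) (Fin.natAdd n j)).toNat) :
    LogChart.IsLogRegularLocal P' φ' := by
  classical
  /- Step 0: elements of `P'` as pairs `(x, w)`, `x ∈ P`, `w ≥ 0`, and the value of `φ'` on them. -/
  have memP' : ∀ (x : P) (w : Fin r' → ℤ), (∀ j, 0 ≤ w j) →
      Fin.append (x : Fin n → ℤ) w ∈ P' := by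
    intro x w hw
    rw [hP']
    refine ⟨?_, fun j => ?_⟩
    · simpa only [Fin.append_left] using x.2
    · simpa only [Fin.append_right] using hw j
  have hsplit : ∀ c : P', (c : Fin (n + r') → ℤ) =
      Fin.append ((⟨fun i : Fin n => (c : Fin (n + r') → ℤ) (Fin.castAdd r' i),
        ((hP' c).1 c.2).1⟩ : P) : Fin n → ℤ) (fun j => (c : Fin (n + r') → ℤ) (Fin.natAdd n j)) :=
    fun c => Fin.append_castAdd_natAdd.symm
  have hwnn : ∀ (c : P') (x : P) (w : Fin r' → ℤ),
      (c : Fin (n + r') → ℤ) = Fin.append (x : Fin n → ℤ) w → ∀ j, 0 ≤ w j := by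
    intro c x w hc j
    have := ((hP' c).1 c.2).2 j
    rwa [hc, Fin.append_right] at this
  have hφ'app : ∀ (c : P') (x : P) (w : Fin r' → ℤ),
      (c : Fin (n + r') → ℤ) = Fin.append (x : Fin n → ℤ) w →
      φ' (Multiplicative.ofAdd c) = φ (Multiplicative.ofAdd x) * ∏ j, u j ^ (w j).toNat := by
    intro c x w hc
    have hx : (⟨fun i : Fin n => (c : Fin (n + r') → ℤ) (Fin.castAdd r' i),
        ((hP' c).1 c.2).1⟩ : P) = x :=
      Subtype.ext (funext fun i => by
        show (c : Fin (n + r') → ℤ) (Fin.castAdd r' i) = (x : Fin n → ℤ) i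
        rw [hc, Fin.append_left])
    rw [hφ', hx, hc]
    simp only [Fin.append_right]
  have hU : ∀ (c : P') (x : P) (w : Fin r' → ℤ),
      (c : Fin (n + r') → ℤ) = Fin.append (x : Fin n → ℤ) w →
      (IsUnit (φ' (Multiplicative.ofAdd c)) ↔
        IsUnit (φ (Multiplicative.ofAdd x)) ∧ ∀ j ∈ J, w j = 0) := by
    intro c x w hc
    rw [hφ'app c x w hc, IsUnit.mul_iff, IsUnit.prod_univ_iff]
    refine and_congr Iff.rfl ⟨fun hu j hj => ?_, fun hz j => ?_⟩
    · have h0 := (isUnit_pow_iff_of_not_isUnit ((hJ j).1 hj)).1 (hu j)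
      exact le_antisymm (Int.toNat_eq_zero.1 h0) (hwnn c x w hc j)
    · by_cases hj : j ∈ J
      · rw [hz j hj, Int.toNat_zero, pow_zero]
        exact isUnit_one
      · exact (not_not.1 (mt (hJ j).2 hj)).pow _
  /- (A) Kato's ideal of `φ'`. -/
  have hI : LogChart.nonunitIdeal P' φ' =
      LogChart.nonunitIdeal P φ ⊔ Ideal.span (u '' (J : Set (Fin r'))) := by
    apply le_antisymm
    · refine Ideal.span_le.2 ?_
      rintro _ ⟨c, hc, rfl⟩
      have hc' : ¬ IsUnit (φ' (Multiplicative.ofAdd c)) := hc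
      rw [hU c _ _ (hsplit c)] at hc'
      show φ' (Multiplicative.ofAdd c) ∈ _
      rw [hφ'app c _ _ (hsplit c)]
      by_cases hx : IsUnit (φ (Multiplicative.ofAdd (⟨fun i : Fin n =>
          (c : Fin (n + r') → ℤ) (Fin.castAdd r' i), ((hP' c).1 c.2).1⟩ : P)))
      · have hj : ∃ j ∈ J, (c : Fin (n + r') → ℤ) (Fin.natAdd n j) ≠ 0 := by
          by_contra hcon
          exact hc' ⟨hx, fun j hj => by_contra fun hne => hcon ⟨j, hj, hne⟩⟩
        obtain ⟨j, hj, hne⟩ := hj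
        refine Ideal.mem_sup_right ?_
        have hdvd : u j ∣ ∏ k, u k ^ ((c : Fin (n + r') → ℤ) (Fin.natAdd n k)).toNat := by
          refine (dvd_pow_self (u j) fun h0 => ?_).trans
            (Finset.dvd_prod_of_mem _ (Finset.mem_univ j))
          exact hne (le_antisymm (Int.toNat_eq_zero.1 h0) (hwnn c _ _ (hsplit c) j))
        obtain ⟨y, hy⟩ := hdvd
        rw [hy, mul_left_comm]
        exact Ideal.mul_mem_right _ _ (Ideal.subset_span ⟨j, hj, rfl⟩)
      · exact Ideal.mem_sup_left (Ideal.mul_mem_right _ _ (Ideal.subset_span ⟨_, hx, rfl⟩))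
    · refine sup_le (Ideal.span_le.2 ?_) (Ideal.span_le.2 ?_)
      · rintro _ ⟨q, hq, rfl⟩
        have hq' : ¬ IsUnit (φ (Multiplicative.ofAdd q)) := hq
        let c : P' := ⟨Fin.append (q : Fin n → ℤ) 0, memP' q 0 fun _ => le_rfl⟩
        have e : φ' (Multiplicative.ofAdd c) = φ (Multiplicative.ofAdd q) := by
          rw [hφ'app c q 0 rfl]
          simp only [Pi.zero_apply, Int.toNat_zero, pow_zero, Finset.prod_const_one, mul_one]
        show φ (Multiplicative.ofAdd q) ∈ LogChart.nonunitIdeal P' φ'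
        rw [← e] at hq' ⊢
        exact Ideal.subset_span ⟨c, hq', rfl⟩
      · rintro _ ⟨j, hj, rfl⟩
        have hj' : ¬ IsUnit (u j) := (hJ j).1 hj
        have hw : ∀ k, 0 ≤ (Pi.single j 1 : Fin r' → ℤ) k := fun k => by
          rcases eq_or_ne k j with rfl | hk
          · simp
          · simp [hk]
        let c : P' := ⟨Fin.append ((0 : P) : Fin n → ℤ) (Pi.single j 1), memP' 0 _ hw⟩
        have e : φ' (Multiplicative.ofAdd c) = u j := by
          rw [hφ'app c 0 _ rfl, ofAdd_zero, map_one, one_mul,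
            Fintype.prod_eq_single j fun k hk => by rw [Pi.single_eq_of_ne hk, Int.toNat_zero,
              pow_zero]]
          rw [Pi.single_eq_same, Int.toNat_one, pow_one]
        show u j ∈ LogChart.nonunitIdeal P' φ'
        rw [← e] at hj' ⊢
        exact Ideal.subset_span ⟨c, hj', rfl⟩
  /- (B) The face of units and the rank of its span. -/
  have h2 := h.2
  set S : Submodule ℤ (Fin n → ℤ) :=
    Submodule.span ℤ ((fun p : P => (p : Fin n → ℤ)) '' LogChart.unitFace P φ) with hSdef
  set S' : Submodule ℤ (Fin (n + r') → ℤ) :=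
    Submodule.span ℤ ((fun p : P' => (p : Fin (n + r') → ℤ)) '' LogChart.unitFace P' φ')
    with hS'def
  let T : (Fin (n + r') → ℤ) ≃ₗ[ℤ] (Fin n → ℤ) × (Fin r' → ℤ) :=
    (Fin.appendEquiv n r').symm.toLinearEquiv
      { map_add := fun _ _ => rfl, map_smul := fun _ _ => rfl }
  have hTsymm : ∀ v, T.symm v = Fin.append v.1 v.2 := fun _ => rfl
  have hS'1 : ∀ c ∈ S', (fun i : Fin n => c (Fin.castAdd r' i)) ∈ S := by
    have hle : S' ≤ S.comap (LinearMap.funLeft ℤ ℤ (Fin.castAdd r')) := by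
      refine Submodule.span_le.2 ?_
      rintro _ ⟨d, hd, rfl⟩
      have hd' := ((hU d _ _ (hsplit d)).1 hd).1
      exact Submodule.subset_span ⟨_, hd', rfl⟩
    exact fun c hc => hle hc
  have hS'2 : ∀ c ∈ S', ∀ j ∈ J, c (Fin.natAdd n j) = 0 := by
    intro c hc j hj
    have hle : S' ≤ LinearMap.ker (LinearMap.proj (R := ℤ) (φ := fun _ : Fin (n + r') => ℤ)
        (Fin.natAdd n j)) := by
      refine Submodule.span_le.2 ?_
      rintro _ ⟨d, hd, rfl⟩
      exact ((hU d _ _ (hsplit d)).1 hd).2 j hj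
    exact hle hc
  have hS'3 : ∀ s ∈ S, T.symm (s, 0) ∈ S' := by
    have hle : S ≤ S'.comap (T.symm.toLinearMap ∘ₗ LinearMap.inl ℤ (Fin n → ℤ) (Fin r' → ℤ)) := by
      refine Submodule.span_le.2 ?_
      rintro _ ⟨f, hf, rfl⟩
      have hc := memP' f 0 fun _ => le_rfl
      have hcF : (⟨_, hc⟩ : P') ∈ LogChart.unitFace P' φ' := by
        rw [LogChart.mem_unitFace_iff, hU ⟨_, hc⟩ f 0 rfl]
        exact ⟨hf, fun j _ => rfl⟩
      exact Submodule.subset_span ⟨_, hcF, rfl⟩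
    exact fun s hs => hle hs
  have hS'4 : ∀ z : Fin r' → ℤ, (∀ j ∈ J, z j = 0) → T.symm (0, z) ∈ S' := by
    have key : ∀ w : Fin r' → ℤ, (∀ j ∈ J, w j = 0) → (∀ j, 0 ≤ w j) → T.symm (0, w) ∈ S' := by
      intro w hwJ hw0
      have hc := memP' 0 w hw0
      have hcF : (⟨_, hc⟩ : P') ∈ LogChart.unitFace P' φ' := by
        rw [LogChart.mem_unitFace_iff, hU ⟨_, hc⟩ 0 w rfl, ofAdd_zero, map_one]
        exact ⟨isUnit_one, hwJ⟩
      have hmem : Fin.append ((0 : P) : Fin n → ℤ) w ∈ S' := Submodule.subset_span ⟨_, hcF, rfl⟩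
      rwa [ZeroMemClass.coe_zero] at hmem
    intro z hz
    have hzeq : ((0 : Fin n → ℤ), z) = ((0 : Fin n → ℤ), fun j => ((z j).toNat : ℤ)) -
        ((0 : Fin n → ℤ), fun j => ((-z j).toNat : ℤ)) := by
      ext j
      · simp
      · simp only [Prod.snd_sub, Pi.sub_apply, Int.toNat_sub_toNat_neg]
    rw [hzeq, map_sub]
    refine S'.sub_mem (key _ (fun j hj => by simp [hz j hj]) fun j => Int.natCast_nonneg _)
      (key _ (fun j hj => by simp [hz j hj]) fun j => Int.natCast_nonneg _)
  have hfin : Module.finrank ℤ S' = Module.finrank ℤ S + (r' - J.card) := by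
    rw [← LinearEquiv.finrank_map_eq T S']
    refine finrank_eq_finrank_add_card_free S J _ (fun v hv => ?_) (fun v hv j hj => ?_)
      (fun s hs => (Submodule.mem_map_equiv S').2 (hS'3 s hs))
      (fun z hz => (Submodule.mem_map_equiv S').2 (hS'4 z hz))
    · have := hS'1 _ ((Submodule.mem_map_equiv S').1 hv)
      simpa only [hTsymm, Fin.append_left] using this
    · have := hS'2 _ ((Submodule.mem_map_equiv S').1 hv) j hj
      simpa only [hTsymm, Fin.append_right] using this
  /- (C) Dimension count. -/
  have hrk : Module.finrank ℤ S ≤ n := by simpa using Submodule.finrank_le S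
  have hJle : J.card ≤ r' := by simpa using J.card_le_univ
  refine ⟨IsRegularLocalRing.of_ringEquiv (Ideal.quotEquivOfEq hI.symm), ?_⟩
  show ringKrullDim R = ringKrullDim (R ⧸ LogChart.nonunitIdeal P' φ') +
    (((n + r') - Module.finrank ℤ S' : ℕ) : WithBot ℕ∞)
  rw [ringKrullDim_eq_of_ringEquiv (Ideal.quotEquivOfEq hI), hfin, h2, ← hdim, add_assoc,
    ← Nat.cast_add]
  congr 2
  omega

end Summit.ResolutionOfSingularities.ResolutionOfSingularities.Theorems.RadicialJung.CleanModelsSuffice
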